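import Literature.AlgebraicGeometry.HodgeTheory.ComplexTorusIntegralHodgeClassesKunnethProjectors
import Literature.AlgebraicGeometry.HodgeTheory.ComplexTorusIntegralHodgeClassesCorrespondenceExteriorProduct
import HarnessLib

/-!
# The Künneth projectors of a product torus: `π_{n, X×X′} = Σ_{s+t=n} π_{s,X} × π_{t,X′}`

Sequel of g29-#4 (`ComplexTorusIntegralHodgeClassesCorrespondenceExteriorProduct`: Fulton's exterior product of correspondences `α × β = q^*α · q′^*β` on
`(X × X′) × (Y × Y′)`, Example 16.1.12 "`(X, p) ⊗ (Y, q) = (X × Y, p × q)`", and `[Δ_{X×X′}] = q^*[Δ_X] · q′^*[Δ_{X′}]`) and g29-#5 (the Künneth projectors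
`π_s = K_s[Δ_X] ∈ Hdgᵍ(X × X, ℤ)`). The Künneth decomposition of the diagonal of a product is the exterior product of the Künneth decompositions of the
factors — the cohomological content of the Künneth formula `h(X × X′) = h(X) ⊗ h(X′)` for Chow–Künneth decompositions, `π_n(X × X′) = Σ_{s+t=n} π_s(X) × π_t(X′)`
(Lange §6.3.4: the `π_i` are the components of `Δ`, (6.15)–(6.16) the eigenspaces of `(1 × n)^*`; Voisin Thm. 11.38: the Künneth decomposition is compatible with
cup products, Lemma 11.41). On the integral carriers of complex tori `X`, `X′` (dimensions `g_X`, `g_{X′}`):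

* §0 (Layer A vocabulary) **`kunnethComponent_sum_wedge_sum`** — `K_n((Σ_s a_s) ∧ (Σ_t b_t)) = Σ_{s,t} δ_{n,s+t} a_s ∧ b_t` for forms `a_s`, `b_t` of pure Künneth types
  `s`, `t` (A4-43 `IsKunnethType.wedge`, `IsKunnethType.kunnethComponent_eq`);
* §1 `realRep` of the projections `q = (p₁ p₁, p₂ p₁)`, `q′ = (p₁ p₂, p₂ p₂) : (X × X′) × (X × X′) → X × X, X′ × X′` (`= fst × fst`, `snd × snd`), so that `q^*`, `q′^*`
  preserve Künneth types (A4-43 `IsKunnethType.compContinuousLinearMap_prodMap`);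
* §2 **`kunnethProjector_prod`** — `π_{n,X×X′} = Σ_{s ≤ 2g_X} Σ_{t ≤ 2g_{X′}} δ_{n,s+t} q^*π_{s,X} · q′^*π_{t,X′}` in `Hdg^{g_X+g_{X′}}((X × X′) × (X × X′), ℤ)`.

## References
* [Lange2023AbelianVarietiesComplex] H. Lange, Abelian Varieties over the Complex Numbers, Springer 2023, §6.3.3 (6.15)–(6.16), §6.3.4 (p0317 L28–L32).
* [Fulton1998] W. Fulton, Intersection Theory, 2nd ed., Springer 1998, §16.1 Example 16.1.12 (p0300 L9–L12, p0301 L9).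
* [VoisinHodgeI2002] C. Voisin, Hodge Theory and Complex Algebraic Geometry I, CUP 2002, §11.3.3 Thm. 11.38, Lemma 11.41.
-/

noncomputable section

open CategoryTheory Function

/-! ### §0 `K_n` of a wedge of sums of pure Künneth types (forms) -/

namespace Literature.Geometry.Kaehler.ComplexTorus

variable {E₁ E₂ : Type*} [NormedAddCommGroup E₁] [NormedSpace ℂ E₁] [NormedAddCommGroup E₂] [NormedSpace ℂ E₂]

/-- The wedge product distributes over finite sums on the right. [folklore] -/
private theorem wedge_sum_right₉ {κ : Type*} (s : Finset κ) {a b : ℕ} (γ : (E₁ × E₂) [⋀^Fin a]→L[ℝ] ℂ)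
    (δ : κ → (E₁ × E₂) [⋀^Fin b]→L[ℝ] ℂ) : γ.wedge (∑ i ∈ s, δ i) = ∑ i ∈ s, γ.wedge (δ i) := by
  classical
  induction s using Finset.induction_on with
  | empty => rw [Finset.sum_empty, Finset.sum_empty, ContinuousAlternatingMap.wedge_zero]
  | insert a s ha ih => rw [Finset.sum_insert ha, Finset.sum_insert ha, ContinuousAlternatingMap.wedge_add_right, ih]

/-- **`K_n((Σ_{s∈S} a_s) ∧ (Σ_{t∈T} b_t)) = Σ_{s∈S} Σ_{t∈T} δ_{n,s+t} · a_s ∧ b_t`** for forms `a_s` of Künneth type `s` and `b_t` of Künneth type `t` (`s + t ≤ k + l`):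
the Künneth grading is multiplicative (`a_s ∧ b_t` has type `s + t`, A4-43 `IsKunnethType.wedge`) and a form of pure type `≤ deg` is its own component
(`IsKunnethType.kunnethComponent_eq`) — Voisin: the Künneth decomposition is compatible with the cup product.
[cite: VoisinHodgeI2002, §11.3.3 Thm. 11.38 and Lemma 11.41] [cite: Lange2023AbelianVarietiesComplex, §6.3.3 (6.15)–(6.16)] -/
theorem kunnethComponent_sum_wedge_sum {k l : ℕ} (S T : Finset ℕ) (a : ℕ → (E₁ × E₂) [⋀^Fin k]→L[ℝ] ℂ) (b : ℕ → (E₁ × E₂) [⋀^Fin l]→L[ℝ] ℂ)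
    (ha : ∀ s ∈ S, IsKunnethType s (a s)) (hb : ∀ t ∈ T, IsKunnethType t (b t)) (hst : ∀ s ∈ S, ∀ t ∈ T, s + t ≤ k + l) (n : ℕ) :
    kunnethComponent n ((∑ s ∈ S, a s).wedge (∑ t ∈ T, b t)) = ∑ s ∈ S, ∑ t ∈ T, if n = s + t then (a s).wedge (b t) else 0 := by
  rw [sum_wedge_left, kunnethComponent_sum]
  refine Finset.sum_congr rfl fun s hs ↦ ?_
  rw [wedge_sum_right₉, kunnethComponent_sum]
  refine Finset.sum_congr rfl fun t ht ↦ ?_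
  exact ((ha s hs).wedge (hb t ht)).kunnethComponent_eq (hst s hs t ht) n

end Literature.Geometry.Kaehler.ComplexTorus

namespace Literature.AlgebraicGeometry.HodgeTheory

open Literature.AlgebraicGeometry.Motives Literature.AlgebraicGeometry.Motives.HodgeStructure
open Literature.Geometry.Kaehler Literature.Geometry.Kaehler.ComplexTorus

namespace ComplexTorusCat

/-! ### §1 The projections `q = fst × fst`, `q′ = snd × snd` of `(X × X′) × (X × X′)` -/

section Projections

variable (X X' : ComplexTorusCat)

/-- `ρ_ℝ(q) = fst × fst` for `q = (p₁ p₁, p₂ p₁) : (X × X′) × (X × X′) → X × X`. [cite: Lange2023AbelianVarietiesComplex, §1.1.2 (p0021 L5)] [cite: Fulton1998, §16.1 Example 16.1.12 (p0300 L9–L12)] -/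
theorem realRep_liftHom_fstHom_fstHom_sndHom_fstHom :
    realRep (prodObj (prodObj X X') (prodObj X X')).toIsog.Φ (prodObj X X).toIsog.Φ
        (liftHom (fstHom (prodObj X X') (prodObj X X') ≫ fstHom X X') (sndHom (prodObj X X') (prodObj X X') ≫ fstHom X X')).1 =
      (ContinuousLinearMap.fst ℝ X.toIsog.E X'.toIsog.E).prodMap (ContinuousLinearMap.fst ℝ X.toIsog.E X'.toIsog.E) := by
  rw [realRep_liftHom, comp_val, comp_val, ← realRep_mul (prodObj (prodObj X X') (prodObj X X')).toIsog.Φ (prodObj X X').toIsog.Φ X.toIsog.Φ,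
    ← realRep_mul (prodObj (prodObj X X') (prodObj X X')).toIsog.Φ (prodObj X X').toIsog.Φ X.toIsog.Φ, realRep_fstHom X X',
    realRep_fstHom (prodObj X X') (prodObj X X'), realRep_sndHom (prodObj X X') (prodObj X X')]
  rfl

/-- `ρ_ℝ(q′) = snd × snd` for `q′ = (p₁ p₂, p₂ p₂) : (X × X′) × (X × X′) → X′ × X′`. [cite: Lange2023AbelianVarietiesComplex, §1.1.2 (p0021 L5)] [cite: Fulton1998, §16.1 Example 16.1.12 (p0300 L9–L12)] -/
theorem realRep_liftHom_fstHom_sndHom_sndHom_sndHom :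
    realRep (prodObj (prodObj X X') (prodObj X X')).toIsog.Φ (prodObj X' X').toIsog.Φ
        (liftHom (fstHom (prodObj X X') (prodObj X X') ≫ sndHom X X') (sndHom (prodObj X X') (prodObj X X') ≫ sndHom X X')).1 =
      (ContinuousLinearMap.snd ℝ X.toIsog.E X'.toIsog.E).prodMap (ContinuousLinearMap.snd ℝ X.toIsog.E X'.toIsog.E) := by
  rw [realRep_liftHom, comp_val, comp_val, ← realRep_mul (prodObj (prodObj X X') (prodObj X X')).toIsog.Φ (prodObj X X').toIsog.Φ X'.toIsog.Φ,
    ← realRep_mul (prodObj (prodObj X X') (prodObj X X')).toIsog.Φ (prodObj X X').toIsog.Φ X'.toIsog.Φ, realRep_sndHom X X',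
    realRep_fstHom (prodObj X X') (prodObj X X'), realRep_sndHom (prodObj X X') (prodObj X X')]
  rfl

end Projections

/-! ### §2 `π_{n,X×X′} = Σ_{s+t=n} q^*π_{s,X} · q′^*π_{t,X′}` -/

section Product

variable (X X' : ComplexTorusCat) {gX gX' gXX gX'X' G GP : ℕ} (hG : gX + gX' = G)
  (eX : Fin (2 * gX) ≃ X.toIsog.ι) (eXX : Fin (2 * gXX) ≃ (prodObj X X).toIsog.ι)
  (hX0 : 2 * gX + 2 * 0 = 2 * gX) (hgX : gX + gX = 2 * gX) (hcX : 2 * gX + 2 * gX = 2 * gXX) (hgXX : gXX + gXX = 2 * gXX)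
  (eX' : Fin (2 * gX') ≃ X'.toIsog.ι) (eX'X' : Fin (2 * gX'X') ≃ (prodObj X' X').toIsog.ι)
  (hX'0 : 2 * gX' + 2 * 0 = 2 * gX') (hgX' : gX' + gX' = 2 * gX') (hcX' : 2 * gX' + 2 * gX' = 2 * gX'X') (hgX'X' : gX'X' + gX'X' = 2 * gX'X')
  (eXX' : Fin (2 * G) ≃ (prodObj X X').toIsog.ι) (ePP : Fin (2 * GP) ≃ (prodObj (prodObj X X') (prodObj X X')).toIsog.ι)
  (hP0 : 2 * G + 2 * 0 = 2 * G) (hgP : G + G = 2 * G) (hcP : 2 * G + 2 * G = 2 * GP) (hgPP : GP + GP = 2 * GP)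

include hgX hgX' in
/-- **THE KÜNNETH PROJECTORS OF A PRODUCT: `π_{n,X×X′} = Σ_{s+t=n} π_{s,X} × π_{t,X′}`**, i.e. in `Hdg^{g_X+g_{X′}}((X × X′) × (X × X′), ℤ)`
`π_{n,X×X′} = Σ_{s ≤ 2g_X} Σ_{t ≤ 2g_{X′}} δ_{n,s+t} · q^*π_{s,X} · q′^*π_{t,X′}` with the projections `q`, `q′` onto `X × X`, `X′ × X′` (Fulton's exterior product
of correspondences, Example 16.1.12 "`(X, p) ⊗ (Y, q) = (X × Y, p × q)`"). Proof: `[Δ_{X×X′}] = q^*[Δ_X] · q′^*[Δ_{X′}]` (g29-#4), `[Δ_X] = Σ_s π_{s,X}`,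
`[Δ_{X′}] = Σ_t π_{t,X′}` (g29-#5), `q^*π_{s,X}` has Künneth type `s` and `q′^*π_{t,X′}` type `t` for the grading of the second factor `X × X′` (§1, A4-43), and §0.
[cite: Fulton1998, §16.1 Example 16.1.12 (p0300 L9–L12, p0301 L9)] [cite: Lange2023AbelianVarietiesComplex, §6.3.4 (p0317 L28–L32) and §6.3.3 (6.15)–(6.16)]
[cite: VoisinHodgeI2002, §11.3.3 Thm. 11.38] -/
theorem kunnethProjector_prod (n : ℕ) :
    kunnethProjector (prodObj X X') eXX' ePP hP0 hgP hcP hgPP n =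
      ∑ s ∈ Finset.range (2 * gX + 1), ∑ t ∈ Finset.range (2 * gX' + 1),
        if n = s + t then
          integralHodgeClassesCup (prodObj (prodObj X X') (prodObj X X')).toIsog.Φ hG
            (integralHodgeClassesPullbackHom
              (liftHom (fstHom (prodObj X X') (prodObj X X') ≫ fstHom X X') (sndHom (prodObj X X') (prodObj X X') ≫ fstHom X X')) gX
              (kunnethProjector X eX eXX hX0 hgX hcX hgXX s))
            (integralHodgeClassesPullbackHom
              (liftHom (fstHom (prodObj X X') (prodObj X X') ≫ sndHom X X') (sndHom (prodObj X X') (prodObj X X') ≫ sndHom X X')) gX'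
              (kunnethProjector X' eX' eX'X' hX'0 hgX' hcX' hgX'X' t))
        else 0 := by
  -- the pulled-back projectors have pure Künneth types for the grading of the second factor `X × X′`
  have ha : ∀ s ∈ Finset.range (2 * gX + 1), IsKunnethType s
      ((integralHodgeClassesPullbackHom
          (liftHom (fstHom (prodObj X X') (prodObj X X') ≫ fstHom X X') (sndHom (prodObj X X') (prodObj X X') ≫ fstHom X X')) gX
          (kunnethProjector X eX eXX hX0 hgX hcX hgXX s) : integralHodgeClasses (prodObj (prodObj X X') (prodObj X X')).toIsog.Φ gX) :
        ((X.toIsog.E × X'.toIsog.E) × (X.toIsog.E × X'.toIsog.E)) [⋀^Fin (2 * gX)]→L[ℝ] ℂ) := fun s _ ↦ by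
    rw [coe_integralHodgeClassesPullbackHom_apply, realRep_liftHom_fstHom_fstHom_sndHom_fstHom, coe_kunnethProjector]
    exact (isKunnethType_kunnethComponent s _).compContinuousLinearMap_prodMap _ _
  have hb : ∀ t ∈ Finset.range (2 * gX' + 1), IsKunnethType t
      ((integralHodgeClassesPullbackHom
          (liftHom (fstHom (prodObj X X') (prodObj X X') ≫ sndHom X X') (sndHom (prodObj X X') (prodObj X X') ≫ sndHom X X')) gX'
          (kunnethProjector X' eX' eX'X' hX'0 hgX' hcX' hgX'X' t) : integralHodgeClasses (prodObj (prodObj X X') (prodObj X X')).toIsog.Φ gX') :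
        ((X.toIsog.E × X'.toIsog.E) × (X.toIsog.E × X'.toIsog.E)) [⋀^Fin (2 * gX')]→L[ℝ] ℂ) := fun t _ ↦ by
    rw [coe_integralHodgeClassesPullbackHom_apply, realRep_liftHom_fstHom_sndHom_sndHom_sndHom, coe_kunnethProjector]
    exact (isKunnethType_kunnethComponent t _).compContinuousLinearMap_prodMap _ _
  have hst : ∀ s ∈ Finset.range (2 * gX + 1), ∀ t ∈ Finset.range (2 * gX' + 1), s + t ≤ 2 * gX + 2 * gX' := fun s hs t ht ↦ by
    have h₁ := Finset.mem_range.1 hs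
    have h₂ := Finset.mem_range.1 ht
    omega
  refine Subtype.ext ?_
  rw [coe_kunnethProjector, integralHodgeClassesPushforward_diagHom_prod_unitIntegralHodgeClass X X' eX eX' eXX' hX0 hgX hX'0 hgX' hP0 hgP hG eX eX' eXX
      eX'X' eXX' ePP hcX hgXX hcX' hgX'X' hcP hgPP, coe_integralHodgeClassesCup, kunnethComponent_domDomCongr_finCongr,
    ← sum_range_kunnethProjector X eX eXX hX0 hgX hcX hgXX, ← sum_range_kunnethProjector X' eX' eX'X' hX'0 hgX' hcX' hgX'X', map_sum, map_sum,
    AddSubmonoidClass.coe_finsetSum, AddSubmonoidClass.coe_finsetSum, kunnethComponent_sum_wedge_sum _ _ _ _ ha hb hst n, domDomCongr_sum,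
    AddSubmonoidClass.coe_finsetSum]
  refine Finset.sum_congr rfl fun s _ ↦ ?_
  rw [domDomCongr_sum, AddSubmonoidClass.coe_finsetSum]
  refine Finset.sum_congr rfl fun t _ ↦ ?_
  split_ifs with h
  · rw [coe_integralHodgeClassesCup]
  · rw [ContinuousAlternatingMap.domDomCongr_zero, ZeroMemClass.coe_zero]

end Product

end ComplexTorusCat

end Literature.AlgebraicGeometry.HodgeTheory
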